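import Mathlib
import HarnessLib
import Summits.Ventures.LatticeQCDFlow.Exactness.SUNResidualLayerJacobian

/-!
# The one-link residual map `u ↦ e^{Q(u)} u` on `SU(N)` is exact for Haar with a continuous positive Jacobian, every `N`

HONEST FRAMING: exact (Metropolis-corrected) sampling algorithms for lattice gauge theory;
figures of merit are autocorrelation/cost numbers at stated couplings and volumes; no
continuum-physics claim.

Venture `LatticeQCDFlow` (cell pub-lqcd), topic `Exactness`; FANOUT row 10 (`eng-equiv`; engine
`equiv/residual.py`, the ONE-LINK residual kernel behind every residual / stout layer).  NEW WORK of
the cell: the group-level form of `SUNResidualLayerJacobian.hasJacobian_sunResidualLayer`, read off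
the one-link lattice `GaugeConfig 1 1 SU(n) ≃ SU(n)` (a single edge, everything active).  No
definition is introduced.

* **`hasJacobian_sunResidualMap`** — for an exponent `Q : M_n(ℂ) → M_n(ℂ)` with values in `𝔰𝔲(n)` on
  `SU(n)`, `κ`-Lipschitz there in the Frobenius norm with `0 ≤ κ < 1` (the engine's guard), agreeing on
  `SU(n)` with a `C²` ambient map `Qamb`: there is a CONTINUOUS, STRICTLY POSITIVE `j : SU(n) → ℝ` with
  `HasJacobian (haarProbability SU(n)) (u ↦ e^{Q(u)} u) (ofReal ∘ j)` — the residual map pushes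
  `j · Haar` forward to `Haar`, for every `n`.  This is the certificate the per-link assembly lemmas
  (`Theory2.hasJacobian_coupleFun`, `KernelCouplingMask.hasJacobian_kernelCouplingLayer`) take as input,
  here for the `SU(N)` residual kernel; no Haar volume form is used anywhere.

Printed counterparts, NAMED ONLY: M. Lüscher, CMP 293 (2010) 899, §3; Morningstar–Peardon, PRD 69
(2004) 054501; Abbott et al., arXiv:2305.02402 §4.2.
-/

noncomputable section

namespace Summit.Ventures.LatticeQCDFlow.Exactness

open Literature.MathematicalPhysics.QuantumFieldTheory
open Literature.MathematicalPhysics.QuantumFieldTheory.Luscher2010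
open Literature.MathematicalPhysics.QuantumFieldTheory.WilsonFlow
open MeasureTheory Filter Set
open scoped Matrix Matrix.Norms.Frobenius Topology ContDiff ENNReal

variable {n : ℕ}

/-- **The one-link `SU(N)` residual map is exact for Haar, every `N`.** -/
theorem hasJacobian_sunResidualMap {Q : Matrix (Fin n) (Fin n) ℂ → Matrix (Fin n) (Fin n) ℂ} {κ : ℝ}
    (hQ : ∀ U ∈ Matrix.specialUnitaryGroup (Fin n) ℂ, (Q U)ᴴ = -Q U ∧ (Q U).trace = 0)
    (hlip : ∀ U ∈ Matrix.specialUnitaryGroup (Fin n) ℂ, ∀ V ∈ Matrix.specialUnitaryGroup (Fin n) ℂ,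
      frobNorm (Q U - Q V) ≤ κ * frobNorm (U - V))
    (hκ0 : 0 ≤ κ) (hκ : κ < 1)
    (Qamb : Matrix (Fin n) (Fin n) ℂ → Matrix (Fin n) (Fin n) ℂ) (hQ2 : ContDiff ℝ 2 Qamb)
    (hQambQ : ∀ U ∈ Matrix.specialUnitaryGroup (Fin n) ℂ, Qamb U = Q U) :
    ∃ j : Matrix.specialUnitaryGroup (Fin n) ℂ → ℝ, Continuous j ∧ (∀ u, 0 < j u) ∧
      HasJacobian (haarProbability (Matrix.specialUnitaryGroup (Fin n) ℂ))
        (fun u : Matrix.specialUnitaryGroup (Fin n) ℂ =>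
          (⟨NormedSpace.exp (Q u) * u, residual_value_mem hQ u.2⟩ : Matrix.specialUnitaryGroup (Fin n) ℂ))
        (fun u => ENNReal.ofReal (j u)) := by
  -- the one-link lattice `Edge 1 1` has exactly one edge
  haveI : Subsingleton (ZMod 1) := inferInstanceAs (Subsingleton (Fin 1))
  haveI hU : Unique (Edge 1 1) := Unique.mk' _
  -- the lattice theorem on `GaugeConfig 1 1 SU(n)` with every link active
  obtain ⟨J, hJc, hJ0, hJ⟩ := hasJacobian_sunResidualLayer (d := 1) (L := 1) (n := n) (fun _ : Edge 1 1 => True)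
    (fun _ _ u => Q u) (fun _ _ => κ) (fun a W => Qamb (W a.1))
    (fun _ _ U hU' => hQ U hU') (fun _ _ U hU' V hV => hlip U hU' V hV) (fun _ _ => hκ0) (fun _ _ => hκ)
    (fun a => hQ2.comp (contDiff_eval a.1)) (fun a U => by rw [coeConfig_apply]; exact hQambQ _ (U a.1).2)
  -- transport along `(Edge 1 1 → SU(n)) ≃ᵐ SU(n)` (evaluation at the unique edge)
  set Φ := MeasurableEquiv.funUnique (Edge 1 1) (Matrix.specialUnitaryGroup (Fin n) ℂ) with hΦ
  have hΦapp : ∀ (V : GaugeConfig 1 1 (Matrix.specialUnitaryGroup (Fin n) ℂ)) (e : Edge 1 1), Φ V = V e := by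
    intro V e
    rw [hΦ, MeasurableEquiv.funUnique_apply]
    exact congrArg V (Subsingleton.elim _ _)
  have hΦsymm : ∀ (u : Matrix.specialUnitaryGroup (Fin n) ℂ), ⇑Φ.symm u = fun _ => u := by
    intro u
    funext e
    rw [hΦ, MeasurableEquiv.funUnique_symm_apply]
    exact uniqueElim_const u e
  have hpres := measurePreserving_funUnique (haarProbability (Matrix.specialUnitaryGroup (Fin n) ℂ)) (Edge 1 1)
  set μ : Measure (GaugeConfig 1 1 (Matrix.specialUnitaryGroup (Fin n) ℂ)) :=
    Measure.pi fun _ : Edge 1 1 => haarProbability (Matrix.specialUnitaryGroup (Fin n) ℂ) with hμ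
  set F := Theory2.coupleFun (fun _ : Edge 1 1 => True) (fun _ _ (u : Matrix.specialUnitaryGroup (Fin n) ℂ) =>
    (⟨NormedSpace.exp (Q (u : Matrix (Fin n) (Fin n) ℂ)) * (u : Matrix (Fin n) (Fin n) ℂ),
      residual_value_mem hQ u.2⟩ : Matrix.specialUnitaryGroup (Fin n) ℂ)) with hF
  set g : Matrix.specialUnitaryGroup (Fin n) ℂ → Matrix.specialUnitaryGroup (Fin n) ℂ := fun u =>
    (⟨NormedSpace.exp (Q (u : Matrix (Fin n) (Fin n) ℂ)) * (u : Matrix (Fin n) (Fin n) ℂ),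
      residual_value_mem hQ u.2⟩ : Matrix.specialUnitaryGroup (Fin n) ℂ) with hg
  -- the layer read through the evaluation is the one-link map
  have hconj : ∀ V : GaugeConfig 1 1 (Matrix.specialUnitaryGroup (Fin n) ℂ), g (Φ V) = Φ (F V) := by
    intro V
    rw [hΦapp V default, hΦapp (F V) default, hF, Theory2.coupleFun_apply_of_pos _ _ trivial]
  have hgm : Measurable g := by
    have hexp : Continuous fun u : Matrix.specialUnitaryGroup (Fin n) ℂ =>
        NormedSpace.exp (Q (u : Matrix (Fin n) (Fin n) ℂ)) := by
      have h1 : Continuous fun u : Matrix.specialUnitaryGroup (Fin n) ℂ => Qamb (u : Matrix (Fin n) (Fin n) ℂ) :=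
        hQ2.continuous.comp continuous_subtype_val
      have h2 : (fun u : Matrix.specialUnitaryGroup (Fin n) ℂ => Qamb (u : Matrix (Fin n) (Fin n) ℂ)) =
          fun u : Matrix.specialUnitaryGroup (Fin n) ℂ => Q (u : Matrix (Fin n) (Fin n) ℂ) :=
        funext fun u => hQambQ _ u.2
      rw [h2] at h1
      exact continuous_matrix_exp.comp h1
    exact ((hexp.mul continuous_subtype_val).subtype_mk _).measurable
  have hJm' : Measurable fun u : Matrix.specialUnitaryGroup (Fin n) ℂ => ENNReal.ofReal (J (Φ.symm u)) :=
    ENNReal.measurable_ofReal.comp (hJc.measurable.comp Φ.symm.measurable)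
  refine ⟨fun u => J (Φ.symm u), ?_, fun u => hJ0 _, ⟨hgm, hJm', ?_⟩⟩
  · -- continuity of `J ∘ Φ⁻¹` (`Φ⁻¹ u` is the constant configuration)
    have hc : Continuous fun u : Matrix.specialUnitaryGroup (Fin n) ℂ => (fun _ : Edge 1 1 => u) :=
      continuous_pi fun _ => continuous_id
    have heq : (fun u => J (Φ.symm u)) = fun u : Matrix.specialUnitaryGroup (Fin n) ℂ => J (fun _ : Edge 1 1 => u) := by
      funext u
      rw [hΦsymm]
    rw [heq]
    exact hJc.comp hc
  · -- transport of `F_* (J · μ) = μ` along `Φ`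
    have hhaar : haarProbability (Matrix.specialUnitaryGroup (Fin n) ℂ) = Measure.map Φ μ := by
      rw [hΦ, hμ]
      convert hpres.map_eq.symm using 3
    have hJm'' : Measurable fun u : Matrix.specialUnitaryGroup (Fin n) ℂ => ENNReal.ofReal (J (Φ.symm u)) := hJm'
    have hdens : (haarProbability (Matrix.specialUnitaryGroup (Fin n) ℂ)).withDensity
        (fun u => ENNReal.ofReal (J (Φ.symm u))) =
        Measure.map Φ (μ.withDensity fun V => ENNReal.ofReal (J V)) := by
      rw [hhaar]
      ext s hs
      rw [withDensity_apply _ hs, Measure.map_apply Φ.measurable hs, withDensity_apply _ (Φ.measurable hs),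
        Measure.restrict_map Φ.measurable hs, lintegral_map hJm'' Φ.measurable]
      refine lintegral_congr fun V => ?_
      rw [Φ.symm_apply_apply]
    rw [hdens, Measure.map_map hgm Φ.measurable]
    have hcomp : g ∘ Φ = Φ ∘ F := funext hconj
    rw [hcomp, ← Measure.map_map Φ.measurable hJ.measurable, hJ.map_eq, ← hhaar]

end Summit.Ventures.LatticeQCDFlow.Exactness

end
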